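import Literature.NumberTheory.Automorphic.Liu2021.Def411WeilCarriersLocalDataAtV
import Literature.NumberTheory.Automorphic.Liu2021.LemD1LocalInjectivity
import HarnessLib

/-!
# [Liu2021, App. D, Lemma D.1 (4)] EXACTLY AS PRINTED, read on an INDEXED collection of Step 1–3 choices (the `n = 2`
# sibling of ★ `LemD1_3AsPrintedI`), and its θ-package instance at a finite place for every rank `≥ 2`

[Liu2021] = Y. Liu, *Fourier–Jacobi cycles and arithmetic relative trace formula*, Camb. J. Math. **9** (2021) 1–147 =
arXiv:2102.11518; `l. NNNN` = lines of the author's TeX source `FJcycle.tex` (md5 `6db49a74122d2cb0f224fa1b39488a0c`, held at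
`run/shared/lean/pub/pub-hodgecm/pub-hodgecm-cf-kudla-howe-rallis-g4/lit/Liu21-arxiv-src/`), as in ★ `Liu2021/LemD1AsPrinted.lean`
(§2: `LemD1Family`, `LemD1.muTwist`, `LemD1.IsIsotropic`, `LemD1_4AsPrinted`) and ★ `Liu2021/LemD1AsPrintedIndexed.lean`
(`LemD1IndexedFamily`, `LemD1_3AsPrintedI`, `LemD1Family.toIndexed`, READING I3), which this file REUSES; nothing is re-declared.

Topic `NumberTheory/Automorphic/Liu2021`; namespaces `Literature.NumberTheory.Automorphic.Liu2021` (§1–§3, generic) and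
`Literature.NumberTheory.Automorphic.Liu2021.Def411WeilCarriers` (§4–§5, the θ-package instance; that of ★
`Def411WeilCarriersLocalDataAtV.lean`).  KERNEL ONLY: one `Prop`-valued predicate on the consumer's datum (`LemD1_4AsPrintedI`), three
definitions with bodies (`localLemD1DataAtV₂`, `localIndexedFamilyAtV₂`, `quotEquivLocalType₂` — the rank-`≥ 2` siblings of the ★ rank-`≥ 3`
ones) and theorems; no named fact, no `instance`, no `notation`, no `sorry`.  NOTHING of [Liu2021] is asserted: `LemD1_4AsPrintedI Lf` is a
PREDICATE on the consumer's OWN indexed data `Lf`; `∀ Lf, LemD1_4AsPrintedI Lf` is not Liu's lemma and no declaration of this file has that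
type; NO PROOF of the lemma (Track 2).

## What this file is, and why (cell `hodgecm-mathlib`, floor 0, P5 row R2′-0′ «θ-package local-factor dictionary», F0P5-plan (g4) 2026-08-31)

The P5 pay-down line `Summits/HodgeConjecture/HodgeConjecture/Cruxes/HLiu418/Lines/F0_P5_CurveThetaLettersPaydown.lean` ED. 3 (commit
1d4b391ebf7c) has the SEMI-LOCAL residual stub R2″ `FlipTransferTwisted₂` = [Liu2021, Lem. D.1 (4)] «assembled over the finite places for ONE
splitting package» on the θ-package local factors (ROUTE P, rows R2′-0′∕a∕b∕c of `F0/P5/TYPER-ROWS-P5-n2.F0P5-plan-g4.md`).  The printed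
item is (l. 5235 = held extraction `paper:arxiv-2102.11518` p0056 L29):

«(4) If `n = 2` and `ω(μ, ε, χ)` is nonzero, then `ω(μ', ε', χ')` is isomorphic to `ω(μ, ε, χ)` if and only if either
`(μ', ε', χ') = (μ, ε, χ)`, or `μ' = μ^c χ̌`, `χ' = χ`, and `ε' = ε` (resp. `ε' ≠ ε`) when `V` is isotropic (resp. anisotropic).»

★ `LemD1_4AsPrinted` (`LemD1AsPrinted.lean` §2) types it over the ALL-TRIPLES family datum `LemD1Family F E n` (ONE ⟨CARRIER⟩ `ω(μ, ε)` for
EVERY Step-2 character `μ ∈ MuSet S` and EVERY Step-1 representative `e ∈ EpsRep S`).  The θ-package of the tree (★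
`GelbartRogawski1991/ChiSplittingLocalFactors.lean`, ★ `Def411WeilCarriersAtChiSplittingOmega.exists_equiv_rhoVAtLine_chiSplittingLine_omega_center`,
★ `Def411WeilCarriersAtChiSplittingTensor.exists_isRestrictedTensorProductRep_chiSplittingLine_omegaPi_center`) constructs local Weil factors ONLY at
the local components of GLOBAL splitting characters `θ` and GLOBAL lines `⟨a⟩`, `a ∈ Fˣ` (the Gram data `gram`∕`hermD` have entries in the number
field): an all-triples instance at a place `v` would need carriers at local triples the consumer never constructs (junk by choice), on which a
cited (4) would speak about junk.  The tree's cure for item (3) is READING I3 of ★ `LemD1AsPrintedIndexed.lean`: read the printed universal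
statement on an INDEXED collection `i ↦ (μ_i, ε_i, χ_i; ω(μ_i, ε_i))` of the consumer's own constructed data — the RESTRICTION along the index
map, WEAKER OR EQUAL to print, and literally §2's reading at the all-triples indexing.  This file does the same for item (4):

* §1 **`LemD1_4AsPrintedI Lf`** — item (4) VERBATIM for every pair of members `i, j` of an indexed family `Lf : LemD1IndexedFamily F E n ι`
  (the summands token for token those of ★ `LemD1_4AsPrinted`: `μ^c χ̌` = ★ `LemD1.muTwist`, «`V` isotropic» = ★ `LemD1.IsIsotropic`,
  «`ε' = ε`» = ★ `LemD1.SameClass`, «isomorphic» = ★ `AreIsomorphicRep`, «nonzero» = the quotient space is `Nontrivial`);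
* §2 `LemD1Family.lemD1_4AsPrinted_iff_toIndexed` — at the all-triples indexing the two readings COINCIDE (`LemD1_4AsPrinted Lf ↔
  LemD1_4AsPrintedI Lf.toIndexed`, summands on the nose); `LemD1_4AsPrintedI.comap` — READING I3 is monotone in the index map;
* §3 the consumer shapes (bookkeeping, all proved): `chi_eq_of_areIsomorphicRep`, `mu_eq_or_eq_muTwist_of_areIsomorphicRep`,
  `sameClass_iff_isIsotropic_of_areIsomorphicRep_of_mu_ne`, `areIsomorphicRep_of_eq`, **`areIsomorphicRep_of_muTwist`** (the COMPANION member
  `(μ^c χ̌, ε', χ)` with `ε'` in the same class iff `V` is isotropic IS isomorphic — the direction R2″ consumes), `areIsomorphicRep_symm_iff`;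
* §4 the θ-package instance for every rank `n ≥ 2`: ★ `Def411WeilCarriersLocalDataAtV.lean` builds `localLemD1DataAtV` ∕ `quotEquivLocalType` ∕
  `localIndexedFamilyAtV` under the binder `(hn : 3 ≤ n)` (item (3)'s range; the binder is used only to derive `2 ≤ N`).  Item (4) lives at
  `n = 2`, so this file gives the rank-`≥ 2` siblings **`localLemD1DataAtV₂`**, **`localIndexedFamilyAtV₂`**, **`quotEquivLocalType₂`** — SAME
  BODIES with `(hn : 2 ≤ n)` — and the `rfl` bridges `localLemD1DataAtV₂_eq` ∕ `localIndexedFamilyAtV₂_eq` to the ★ objects when `3 ≤ n`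
  (so the rank-3 consumers see the same terms);
* §5 the READ-BACKS asked by F0P5-plan (g4) (F0/P5 bus 2026-08-31T16:13:34Z): **(r1)** `areIsomorphicRep_localType₂_iff_quot` — for members
  `i, j` of `localIndexedFamilyAtV₂ … v` the as-printed «isomorphic» of the family's `ω(μ_{j,v}, ε_{j,v}, χ_{j,v})`, `ω(μ_{i,v}, ε_{i,v}, χ_{i,v})`
  (`quot`, on `U(V)(F_v) = S.U`) IS «isomorphic» of the θ-package LOCAL FACTORS `Θ_v(i) := TwistedCoinv.rep (localCharOfCenter χ_i v)
  ((𝓢_i).omegaLoc v) _ ∘ (k ↦ k ⊗ 1)` of `U(J_V)(F_v)` (through `quotEquivLocalType₂` and the onto `uEquiv`), and `nontrivial_localType₂_iff_quot`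
  likewise for «nonzero»; hence **`lemD1_4_localFactors_of_lemD1_4AsPrintedI₂`** — the cite `LemD1_4AsPrintedI (localIndexedFamilyAtV₂ … v)`
  SAYS, for `N = 2`, members `i, j` with `Θ_v(i) ≠ 0`: «`Θ_v(j) ≅ Θ_v(i)` ↔ (`μ_{j,v} = μ_{i,v}` ∧ `(a_jδ)⊗1 ~ (a_iδ)⊗1` ∧ `χ_{j,v}∘θ = χ_{i,v}∘θ`)
  ∨ (`μ_{j,v} = μ_{i,v}^c · χ̌_{i,v}` ∧ `χ_{j,v}∘θ = χ_{i,v}∘θ` ∧ (`V_v` isotropic → same class) ∧ (`V_v` anisotropic → different class))» —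
  ONE splitting family per member (`𝓢_i`), no det-twist (that is the GLOBAL stub R2G of the line), exactly the local tokens of R2″;
  **(r2)** the `⊗'`-assembly of these local factors into [Liu2021, Def. 4.11]'s finite-adelic carrier at the line `⟨a⟩` is ★ and is CITED BY
  NAME, not re-proved: `Def411WeilCarriers.exists_equiv_rhoVAtLine_chiSplittingLine_omega_center` (Def411WeilCarriersAtChiSplittingOmega.lean :261)
  and `Def411WeilCarriers.exists_isRestrictedTensorProductRep_chiSplittingLine_omegaPi_center` (Def411WeilCarriersAtChiSplittingTensor.lean :217);
  **(r3)** FLAGGED, not typed: in the second summand `LemD1.muTwist (mu i) (chi i)` is the LOCAL character `μ_{i,v}^c · S.check (χ_{i,v} ∘ θ)`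
  (★ `LemD1AsPrinted` :482); identifying it with `LemD1OfPlace.muOf` of the local component at `v` of the GLOBAL companion label
  `galConj 𝔠 λ · HeckeCharacter.checkOfChi hcc χ` (★ `CheckOfChiCompanionCharacter`) at a place `w ∣ v` split over `F` is exactly the
  bookkeeping `TODO(valueAtUniformizer_checkOfChi)` of ★ `CheckOfChi.lean` (header, ll. 23–25) — a junction THEOREM owed by the R2″ prover,
  no fact minted here.

Books: +0 named facts (the record is a predicate on the consumer's datum, as ★ `LemD1_3AsPrintedI`).  HC_CM is proved only modulo the
printed citations (2 remaining named inputs `hLiu418`, `h413`; behind them the booked printed statements + the MOD package) until rung 0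
closes; NOTHING here proves HC_CM or closes a stub.

## References
* [Liu2021] Y. Liu, *Fourier–Jacobi cycles and arithmetic relative trace formula*, Camb. J. Math. 9 (2021) = arXiv:2102.11518 — App. D §D.1
  Steps 1–3 (l. 5213–5224), Lemma D.1 (`le:weil_nonarch`, l. 5226–5237), item (4) (l. 5235) and its proof (l. 5255–5262: «we first have
  `χ = χ'`. By the description of endoscopic packets in [GGP2, Section 8], we must have either `μ' = μ` or `μ' = μ^c χ̌` …»); Def. 4.11
  (l. 2083–2097).
* [GelbartRogawski1991] S. Gelbart, J. Rogawski, *L-functions and Fourier–Jacobi coefficients for the unitary group U(3)*, Invent. Math. 105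
  (1991), §3.1 p. 454, Prop. 3.1.1 p. 455 L1–3 (the dual pair and its local Weil representation, through ★ `Def411WeilCarriersLocalDataAtV`).
* [Mok2014] C. P. Mok, Mem. AMS 235 (2015), §1 Notation p. 5 (`U(J)(F_v)`, through ★ `LemD1DataOfPlace`).
-/

set_option autoImplicit false

noncomputable section

open scoped Matrix Kronecker RestrictedProduct NumberField Classical
open NumberField IsDedekindDomain Filter Set
open Literature.NumberTheory Literature.NumberTheory.Automorphic Literature.NumberTheory.Automorphic.UnitaryGroup
open Literature.NumberTheory.GelbartRogawski1991 Literature.NumberTheory.GelbartRogawski1991.UnitaryDualPair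
open Literature.NumberTheory.GelbartRogawski1991.UnitaryDualPair.WeilCoinv
open Literature.NumberTheory.Weil1964 Literature.RepresentationTheory
open Literature.RepresentationTheory.CentralCharacterQuotient (augmentation)

namespace Literature.NumberTheory.Automorphic.Liu2021

/-! ## §1 Lemma D.1 (4), exactly as printed, over an indexed collection of Step 1–3 choices -/

/-- **[Liu2021, App. D, Lemma D.1 (4)] EXACTLY AS PRINTED** (`FJcycle.tex` l. 5235 = `paper:arxiv-2102.11518` p0056 L29): «If `n = 2`
and `ω(μ, ε, χ)` is nonzero, then `ω(μ', ε', χ')` is isomorphic to `ω(μ, ε, χ)` if and only if either `(μ', ε', χ') = (μ, ε, χ)`, or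
`μ' = μ^c χ̌`, `χ' = χ`, and `ε' = ε` (resp. `ε' ≠ ε`) when `V` is isotropic (resp. anisotropic).»  TYPED, on the indexed collection
(READING I3 of ★ `LemD1AsPrintedIndexed`: the printed universal statement over two choices of Step 1–3 data, restricted along the index
map; weaker or equal to print): for `n = 2`, every member `i` with `ω(μ_i, ε_i, χ_i)` nonzero (the quotient space non-trivial, READING L5)
and every member `j`: `ω(μ_j, ε_j, χ_j) ≅ ω(μ_i, ε_i, χ_i)` (READING L7, ★ `AreIsomorphicRep`) iff EITHER `μ_j = μ_i ∧ ε_j = ε_i` in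
`E^{−×}/Nm E^×` (★ `LemD1.SameClass`, READING L3′) `∧ χ_j = χ_i`, OR `μ_j = μ_i^c χ̌_i` (★ `LemD1.muTwist`, `χ̌ = S.check χ`) `∧ χ_j = χ_i ∧`
(`V` isotropic `→` same class) `∧` (`V` anisotropic `→` different class) — the summands token for token those of ★ `LemD1_4AsPrinted`.  At
the all-triples indexing this IS `LemD1_4AsPrinted` (`LemD1Family.lemD1_4AsPrinted_iff_toIndexed`).  A predicate on `Lf`; not asserted;
NO PROOF. [cite: Liu2021, App. D Lemma D.1 (4) (l. 5235)] -/
def LemD1_4AsPrintedI {F E : Type} [Field F] [ValuativeRel F] [TopologicalSpace F] [CommRing E] [Algebra F E]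
    [TopologicalSpace E] [IsTopologicalRing E] {n : ℕ} {ι : Type} (Lf : LemD1IndexedFamily F E n ι) : Prop :=
  letI : IsModuleTopology F E := Lf.isModuleTopology
  n = 2 → ∀ i : ι, Nontrivial (Lf.V i ⧸ augmentation (Lf.omega i) Lf.S.scalar (Lf.chi i).1) → ∀ j : ι,
    AreIsomorphicRep (Lf.quot j) (Lf.quot i) ↔
      ((Lf.mu j = Lf.mu i ∧ LemD1.SameClass (Lf.eps i) (Lf.eps j) ∧ Lf.chi j = Lf.chi i) ∨
        (Lf.mu j = LemD1.muTwist (Lf.mu i) (Lf.chi i) ∧ Lf.chi j = Lf.chi i ∧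
          (LemD1.IsIsotropic Lf.S → LemD1.SameClass (Lf.eps i) (Lf.eps j)) ∧
          (¬ LemD1.IsIsotropic Lf.S → ¬ LemD1.SameClass (Lf.eps i) (Lf.eps j))))

/-! ## §2 §2's all-triples family as an indexed collection: the two readings of (4) coincide; re-indexing -/

namespace LemD1Family

variable {F E : Type} [Field F] [ValuativeRel F] [TopologicalSpace F] [CommRing E] [Algebra F E]
  [TopologicalSpace E] [IsTopologicalRing E] {n : ℕ} (Lf : LemD1Family F E n)

/-- **READING I3 is §2's reading at the all-triples indexing**: `LemD1_4AsPrinted Lf ↔ LemD1_4AsPrintedI Lf.toIndexed` (the summands agree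
on the nose; only the bookkeeping of the triples `(μ, ε, χ)` ∕ `(μ', ε', χ')` as members is rearranged).
[cite: Liu2021, App. D Lemma D.1 (4) (l. 5235)] -/
theorem lemD1_4AsPrinted_iff_toIndexed : LemD1_4AsPrinted Lf ↔ LemD1_4AsPrintedI Lf.toIndexed :=
  ⟨fun h hn i hi j => h hn i.1 i.2.1 i.2.2 hi j.1 j.2.1 j.2.2, fun h hn μ e χ hne μ' e' χ' => h hn (μ, e, χ) hne (μ', e', χ')⟩

end LemD1Family

namespace LemD1_4AsPrintedI

variable {F E : Type} [Field F] [ValuativeRel F] [TopologicalSpace F] [CommRing E] [Algebra F E]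
  [TopologicalSpace E] [IsTopologicalRing E] {n : ℕ} {ι : Type} {Lf : LemD1IndexedFamily F E n ι}

/-- **Re-indexing**: item (4) read on a collection holds on every sub-collection `comap f` (READING I3 is monotone in the index map).
[cite: Liu2021, App. D Lemma D.1 (4) (l. 5235)] -/
theorem comap (h4 : LemD1_4AsPrintedI Lf) {κ : Type} (f : κ → ι) : LemD1_4AsPrintedI (Lf.comap f) :=
  fun hn k hk l => h4 hn (f k) hk (f l)

/-! ## §3 Consequences in the shapes the consumers use (bookkeeping; every declaration below is proved) -/

/-- Item (4) in use: isomorphic members (with `ω(μ_i, ε_i, χ_i) ≠ 0`, `n = 2`) have the SAME Step-3 character `χ` (both printed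
alternatives carry `χ' = χ`; Liu's proof l. 5255: «we first have `χ = χ'`»). [cite: Liu2021, App. D Lemma D.1 (4) (l. 5235)] -/
theorem chi_eq_of_areIsomorphicRep (h4 : LemD1_4AsPrintedI Lf) (hn : n = 2) {i j : ι}
    (hi : Nontrivial (Lf.V i ⧸ augmentation (Lf.omega i) Lf.S.scalar (Lf.chi i).1))
    (hiso : AreIsomorphicRep (Lf.quot j) (Lf.quot i)) : Lf.chi j = Lf.chi i := by
  rcases (h4 hn i hi j).1 hiso with ⟨_, _, h⟩ | ⟨_, h, _, _⟩ <;> exact h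

/-- Item (4) in use: isomorphic members have Step-2 characters EQUAL or COMPANION (`μ_j = μ_i` or `μ_j = μ_i^c χ̌_i`; Liu's proof
l. 5255: «we must have either `μ' = μ` or `μ' = μ^c χ̌`»). [cite: Liu2021, App. D Lemma D.1 (4) (l. 5235)] -/
theorem mu_eq_or_eq_muTwist_of_areIsomorphicRep (h4 : LemD1_4AsPrintedI Lf) (hn : n = 2) {i j : ι}
    (hi : Nontrivial (Lf.V i ⧸ augmentation (Lf.omega i) Lf.S.scalar (Lf.chi i).1))
    (hiso : AreIsomorphicRep (Lf.quot j) (Lf.quot i)) :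
    letI : IsModuleTopology F E := Lf.isModuleTopology
    Lf.mu j = Lf.mu i ∨ Lf.mu j = LemD1.muTwist (Lf.mu i) (Lf.chi i) := by
  rcases (h4 hn i hi j).1 hiso with ⟨h, _, _⟩ | ⟨h, _, _, _⟩
  · exact Or.inl h
  · exact Or.inr h

/-- Item (4) in use: if isomorphic members have DIFFERENT Step-2 characters, then the representatives of `ε` lie in the same class
EXACTLY WHEN `V` is isotropic («`ε' = ε` (resp. `ε' ≠ ε`) when `V` is isotropic (resp. anisotropic)»).
[cite: Liu2021, App. D Lemma D.1 (4) (l. 5235)] -/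
theorem sameClass_iff_isIsotropic_of_areIsomorphicRep_of_mu_ne (h4 : LemD1_4AsPrintedI Lf) (hn : n = 2) {i j : ι}
    (hi : Nontrivial (Lf.V i ⧸ augmentation (Lf.omega i) Lf.S.scalar (Lf.chi i).1))
    (hiso : AreIsomorphicRep (Lf.quot j) (Lf.quot i)) (hne : Lf.mu j ≠ Lf.mu i) :
    LemD1.SameClass (Lf.eps i) (Lf.eps j) ↔ LemD1.IsIsotropic Lf.S := by
  rcases (h4 hn i hi j).1 hiso with ⟨h, _, _⟩ | ⟨_, _, hiso', han⟩
  · exact absurd h hne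
  · exact ⟨fun hs => by_contra fun hV => han hV hs, fun hV => hiso' hV⟩

/-- … in particular, in that case the Step-2 character of `j` IS the companion `μ_i^c χ̌_i`.
[cite: Liu2021, App. D Lemma D.1 (4) (l. 5235)] -/
theorem mu_eq_muTwist_of_areIsomorphicRep_of_mu_ne (h4 : LemD1_4AsPrintedI Lf) (hn : n = 2) {i j : ι}
    (hi : Nontrivial (Lf.V i ⧸ augmentation (Lf.omega i) Lf.S.scalar (Lf.chi i).1))
    (hiso : AreIsomorphicRep (Lf.quot j) (Lf.quot i)) (hne : Lf.mu j ≠ Lf.mu i) :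
    letI : IsModuleTopology F E := Lf.isModuleTopology
    Lf.mu j = LemD1.muTwist (Lf.mu i) (Lf.chi i) := by
  rcases (h4 hn i hi j).1 hiso with ⟨h, _, _⟩ | ⟨h, _, _, _⟩
  · exact absurd h hne
  · exact h

/-- Item (4), converse direction as printed («if and only if»), first alternative: equal parameters — the representatives of `ε` in the
same class — give isomorphic `ω`'s (`n = 2`, `ω(μ_i, ε_i, χ_i) ≠ 0`). [cite: Liu2021, App. D Lemma D.1 (4) (l. 5235)] -/
theorem areIsomorphicRep_of_eq (h4 : LemD1_4AsPrintedI Lf) (hn : n = 2) {i j : ι}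
    (hi : Nontrivial (Lf.V i ⧸ augmentation (Lf.omega i) Lf.S.scalar (Lf.chi i).1))
    (hμ : Lf.mu j = Lf.mu i) (he : LemD1.SameClass (Lf.eps i) (Lf.eps j)) (hχ : Lf.chi j = Lf.chi i) :
    AreIsomorphicRep (Lf.quot j) (Lf.quot i) :=
  (h4 hn i hi j).2 (Or.inl ⟨hμ, he, hχ⟩)

/-- **Item (4), converse direction as printed, second alternative — THE COMPANION MEMBER IS ISOMORPHIC**: a member `j` with
`μ_j = μ_i^c χ̌_i`, `χ_j = χ_i`, and `ε_j` in the class of `ε_i` if `V` is isotropic, in the other class if `V` is anisotropic, satisfies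
`ω(μ_j, ε_j, χ_j) ≅ ω(μ_i, ε_i, χ_i)` (`n = 2`, `ω(μ_i, ε_i, χ_i) ≠ 0`).  The direction the P5 residual R2″ consumes place by place.
[cite: Liu2021, App. D Lemma D.1 (4) (l. 5235)] -/
theorem areIsomorphicRep_of_muTwist (h4 : LemD1_4AsPrintedI Lf) (hn : n = 2) {i j : ι}
    (hi : Nontrivial (Lf.V i ⧸ augmentation (Lf.omega i) Lf.S.scalar (Lf.chi i).1))
    (hμ : letI : IsModuleTopology F E := Lf.isModuleTopology; Lf.mu j = LemD1.muTwist (Lf.mu i) (Lf.chi i))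
    (hχ : Lf.chi j = Lf.chi i)
    (hiso : LemD1.IsIsotropic Lf.S → LemD1.SameClass (Lf.eps i) (Lf.eps j))
    (han : ¬ LemD1.IsIsotropic Lf.S → ¬ LemD1.SameClass (Lf.eps i) (Lf.eps j)) :
    AreIsomorphicRep (Lf.quot j) (Lf.quot i) :=
  (h4 hn i hi j).2 (Or.inr ⟨hμ, hχ, hiso, han⟩)

/-- … isotropic `V`: the companion member with `ε_j` in the SAME class is isomorphic. [cite: Liu2021, App. D Lemma D.1 (4) (l. 5235)] -/
theorem areIsomorphicRep_of_muTwist_of_isIsotropic (h4 : LemD1_4AsPrintedI Lf) (hn : n = 2) {i j : ι}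
    (hi : Nontrivial (Lf.V i ⧸ augmentation (Lf.omega i) Lf.S.scalar (Lf.chi i).1))
    (hμ : letI : IsModuleTopology F E := Lf.isModuleTopology; Lf.mu j = LemD1.muTwist (Lf.mu i) (Lf.chi i))
    (hχ : Lf.chi j = Lf.chi i) (hV : LemD1.IsIsotropic Lf.S) (he : LemD1.SameClass (Lf.eps i) (Lf.eps j)) :
    AreIsomorphicRep (Lf.quot j) (Lf.quot i) :=
  h4.areIsomorphicRep_of_muTwist hn hi hμ hχ (fun _ => he) (fun h => absurd hV h)

/-- … anisotropic `V`: the companion member with `ε_j` in the OTHER class is isomorphic. [cite: Liu2021, App. D Lemma D.1 (4) (l. 5235)] -/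
theorem areIsomorphicRep_of_muTwist_of_not_isIsotropic (h4 : LemD1_4AsPrintedI Lf) (hn : n = 2) {i j : ι}
    (hi : Nontrivial (Lf.V i ⧸ augmentation (Lf.omega i) Lf.S.scalar (Lf.chi i).1))
    (hμ : letI : IsModuleTopology F E := Lf.isModuleTopology; Lf.mu j = LemD1.muTwist (Lf.mu i) (Lf.chi i))
    (hχ : Lf.chi j = Lf.chi i) (hV : ¬ LemD1.IsIsotropic Lf.S) (he : ¬ LemD1.SameClass (Lf.eps i) (Lf.eps j)) :
    AreIsomorphicRep (Lf.quot j) (Lf.quot i) :=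
  h4.areIsomorphicRep_of_muTwist hn hi hμ hχ (fun h => absurd h hV) (fun _ => he)

/-- «isomorphic» (READING L7) is symmetric, so the cite may be consumed with the roles of `i`, `j` exchanged in the conclusion.
[cite: Liu2021, App. D Lemma D.1 (4) (l. 5235)] -/
theorem areIsomorphicRep_symm_iff {i j : ι} : AreIsomorphicRep (Lf.quot j) (Lf.quot i) ↔ AreIsomorphicRep (Lf.quot i) (Lf.quot j) :=
  ⟨AreIsomorphicRep.symm, AreIsomorphicRep.symm⟩

end LemD1_4AsPrintedI

end Literature.NumberTheory.Automorphic.Liu2021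

/-! ## §4 The θ-package instance at a finite place for every rank `n ≥ 2` (siblings of the ★ rank-`≥ 3` objects) -/

namespace Literature.NumberTheory.Automorphic.Liu2021.Def411WeilCarriers

variable (F E : Type) [Field F] [NumberField F] [Field E] [NumberField E] [Algebra F E]
variable (c : E ≃ₐ[F] E) (N : ℕ) {n : ℕ} (e : Fin N × Fin 1 ≃ Fin n)
variable (JV : Matrix (Fin N) (Fin N) E) {TV : Matrix (Fin N) (Fin N) F}
variable [Algebra.IsQuadraticExtension F E] {δ : E} (hcδ : c δ = -δ) (hδ : δ ≠ 0) {d : F} (hd : δ * δ = algebraMap F E d)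
/- (every further binder explicit per declaration — no section `variable` carrying a hypothesis) -/

section Rank

/-- `2 ≤ N` when `2 ≤ n`, for `e : Fin N × Fin 1 ≃ Fin n` (`N = n`; plumbing). [folklore] -/
private theorem two_le_rank₂ (e : Fin N × Fin 1 ≃ Fin n) (hn : 2 ≤ n) : 2 ≤ N := by
  have h : N = n := by simpa using Fintype.card_congr e
  omega

end Rank

section LocalData

/-- **[Liu2021, App. D §D.1]'s data at `v` for the hermitian space `V = (E^N, J_V)` ITSELF, every rank `n ≥ 2`** — the rank-`≥ 2` sibling of ★
`localLemD1DataAtV` (which carries `3 ≤ n` for item (3)); SAME BODY: standing data `LemD1OfPlace.standingData` at `J_V`, Step 1 `epsLine a v =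
(a·δ) ⊗ 1`, Step 2 `μ_v`, Step 3 `χ_v ∘ θ` (`χ_v = localCharOfCenter … (J_W a) χ v`), ⟨CARRIER⟩ `(𝓢.omegaLoc v) ∘ (k ↦ k ⊗ 1) ∘ uEquiv`.  At
`3 ≤ n` it IS the ★ datum (`localLemD1DataAtV₂_eq`, `rfl`).  Lemma D.1 for THIS datum is a hypothesis of the consumer — not claimed.
[cite: Liu2021, App. D §D.1 Steps 1∕2∕3 (l. 5213–5224)] [cite: Mok2014, §1 Notation p. 5] -/
def localLemD1DataAtV₂ (hV : TV.IsSymm) (hVd : IsUnit TV.det)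
    (hJV : JV = TV.map (algebraMap F E)) (a : Fˣ)
    (𝓢 : LocalSplitting.FinLocalSplittings F E c n hcδ hδ hd (gram F e TV (TW F a)) (isSymm_gram F e hV (isSymm_TW F a))
      (reindex_kronecker_eq_gram_map F E e hJV (JW_eq F E a)))
    (hn : 2 ≤ n) (μ : ∀ v : HeightOneSpectrum (𝓞 F), (LocalRing E v)ˣ →* ℂˣ) (hμn : ∀ v x, ‖((μ v x : ℂˣ) : ℂ)‖ = 1)
    (hμc : ∀ v, Continuous fun x => ((μ v x : ℂˣ) : ℂ))
    (hμF : ∀ (v : HeightOneSpectrum (𝓞 F)) (t : (v.adicCompletion F)ˣ),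
      μ v (Units.map (algebraMap (v.adicCompletion F) (LocalRing E v)).toMonoidHom t) = 1 ↔
        ∃ x : (LocalRing E v)ˣ, (x : LocalRing E v) * conjLocal E c v x = algebraMap (v.adicCompletion F) (LocalRing E v) t)
    (χ : Chi F E c) (v : HeightOneSpectrum (𝓞 F)) :
    LemD1Data (v.adicCompletion F) (LocalRing E v) N (SchwartzBruhat (Fin n → v.adicCompletion F)) where
  isNonarchimedeanLocalField := inferInstance
  isModuleTopology := LemD1OfPlace.isModuleTopology_localRing E v
  S := LemD1OfPlace.standingData E v c N JV hcδ hδ (two_le_rank₂ N e hn) (transpose_map_conj_JV F E c N JV hV hJV)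
    (det_JV_ne_zero F E N JV hVd hJV)
  eps := epsLine E hδ a v
  eps_mem_skew := epsLine_mem_skew E c N JV hcδ hδ (two_le_rank₂ N e hn) (transpose_map_conj_JV F E c N JV hV hJV)
    (det_JV_ne_zero F E N JV hVd hJV) a v
  mu := μ v
  norm_mu := hμn v
  continuous_mu := hμc v
  mu_algebraMap_eq_one_iff := hμF v
  chi := (localCharOfCenter F E c (JW F E a) (JW_apply_ne_zero F E a) χ.1 v).comp
    (LemD1OfPlace.theta E v c N JV hcδ hδ (two_le_rank₂ N e hn) (transpose_map_conj_JV F E c N JV hV hJV)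
      (det_JV_ne_zero F E N JV hVd hJV) (JW F E a))
  norm_chi _ := norm_localCharOfCenter F E c (JW F E a) (JW_apply_ne_zero F E a)
    (norm_chi_eq_one F E c (Algebra.IsQuadraticExtension.finrank_eq_two F E) (UnitaryGroup.algEquiv_ne_one_of_apply_eq_neg F E c hcδ hδ) χ)
    v _
  continuous_chi := (continuous_coe_localCharOfCenter F E c (JW F E a) (JW_apply_ne_zero F E a) χ.2.1 v).comp
    (LemD1OfPlace.continuous_theta E v c N JV hcδ hδ (two_le_rank₂ N e hn) (transpose_map_conj_JV F E c N JV hV hJV)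
      (det_JV_ne_zero F E N JV hVd hJV) (JW F E a))
  omega := (show Representation ℂ (UnitaryGroup.localPi E c N JV v) (SchwartzBruhat (Fin n → v.adicCompletion F)) from
      (𝓢.omegaLoc v).comp (UnitaryGroup.localLineInl E c N e JV (JW F E a) v)).comp
    (LemD1OfPlace.uEquiv E v c N JV hcδ hδ (two_le_rank₂ N e hn) (transpose_map_conj_JV F E c N JV hV hJV)
      (det_JV_ne_zero F E N JV hVd hJV)).toMulEquiv.toMonoidHom

/-- **IDENTITY OF RECORDS across ranks**: at `3 ≤ n` the rank-`≥ 2` datum IS the ★ rank-`≥ 3` datum `localLemD1DataAtV` (`rfl`; the two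
differ only in the proof of `2 ≤ N` fed to the standing data). [cite: Liu2021, App. D §D.1 Steps 1∕2∕3 (l. 5213–5224)] -/
theorem localLemD1DataAtV₂_eq (hV : TV.IsSymm) (hVd : IsUnit TV.det)
    (hJV : JV = TV.map (algebraMap F E)) (a : Fˣ)
    (𝓢 : LocalSplitting.FinLocalSplittings F E c n hcδ hδ hd (gram F e TV (TW F a)) (isSymm_gram F e hV (isSymm_TW F a))
      (reindex_kronecker_eq_gram_map F E e hJV (JW_eq F E a)))
    (hn : 3 ≤ n) (μ : ∀ v : HeightOneSpectrum (𝓞 F), (LocalRing E v)ˣ →* ℂˣ) (hμn : ∀ v x, ‖((μ v x : ℂˣ) : ℂ)‖ = 1)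
    (hμc : ∀ v, Continuous fun x => ((μ v x : ℂˣ) : ℂ))
    (hμF : ∀ (v : HeightOneSpectrum (𝓞 F)) (t : (v.adicCompletion F)ˣ),
      μ v (Units.map (algebraMap (v.adicCompletion F) (LocalRing E v)).toMonoidHom t) = 1 ↔
        ∃ x : (LocalRing E v)ˣ, (x : LocalRing E v) * conjLocal E c v x = algebraMap (v.adicCompletion F) (LocalRing E v) t)
    (χ : Chi F E c) (v : HeightOneSpectrum (𝓞 F)) :
    localLemD1DataAtV₂ F E c N e JV hcδ hδ hd hV hVd hJV a 𝓢 (le_trans (by norm_num) hn) μ hμn hμc hμF χ v =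
      localLemD1DataAtV F E c N e JV hcδ hδ hd hV hVd hJV a 𝓢 hn μ hμn hμc hμF χ v := rfl

/-- **The datum's `ω(μ_v, ε_v, χ_v)` IS the θ-package local factor `Θ_v = TwistedCoinv.rep χ_v ω_v _ ∘ (k ↦ k ⊗ 1)` read on `U(V)(F_v) = S.U`
along `uEquiv`, every rank `n ≥ 2`** — the rank-`≥ 2` sibling of ★ `quotEquivLocalType`, SAME BODY (equivariant identification, data;
identity on representatives: `augmentation = ker`, ★ `LemD1OfPlace.coinvEquiv`, `θ` onto, ★ `ker_comp_localLineInl_eq`).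
[cite: Liu2021, App. D §D.1 Step 3 (l. 5221)] [cite: Mok2014, §1 Notation p. 5] -/
def quotEquivLocalType₂ (hV : TV.IsSymm) (hVd : IsUnit TV.det)
    (hJV : JV = TV.map (algebraMap F E)) (a : Fˣ)
    (𝓢 : LocalSplitting.FinLocalSplittings F E c n hcδ hδ hd (gram F e TV (TW F a)) (isSymm_gram F e hV (isSymm_TW F a))
      (reindex_kronecker_eq_gram_map F E e hJV (JW_eq F E a)))
    (hn : 2 ≤ n) (μ : ∀ v : HeightOneSpectrum (𝓞 F), (LocalRing E v)ˣ →* ℂˣ) (hμn : ∀ v x, ‖((μ v x : ℂˣ) : ℂ)‖ = 1)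
    (hμc : ∀ v, Continuous fun x => ((μ v x : ℂˣ) : ℂ))
    (hμF : ∀ (v : HeightOneSpectrum (𝓞 F)) (t : (v.adicCompletion F)ˣ),
      μ v (Units.map (algebraMap (v.adicCompletion F) (LocalRing E v)).toMonoidHom t) = 1 ↔
        ∃ x : (LocalRing E v)ˣ, (x : LocalRing E v) * conjLocal E c v x = algebraMap (v.adicCompletion F) (LocalRing E v) t)
    (χ : Chi F E c) (v : HeightOneSpectrum (𝓞 F)) :
    ((localLemD1DataAtV₂ F E c N e JV hcδ hδ hd hV hVd hJV a 𝓢 hn μ hμn hμc hμF χ v).datum.quot).Equiv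
      ((show Representation ℂ (UnitaryGroup.localPi E c N JV v) _ from
        (TwistedCoinv.rep (localCharOfCenter F E c (JW F E a) (JW_apply_ne_zero F E a) χ.1 v) (𝓢.omegaLoc v)
          (commute_omegaLoc_localCenter F E c N e JV (JW F E a) hcδ hδ hd hV (isSymm_TW F a) hJV (JW_eq F E a)
            (JW_apply_ne_zero F E a) 𝓢 v)).comp (UnitaryGroup.localLineInl E c N e JV (JW F E a) v)).comp
        (LemD1OfPlace.uEquiv E v c N JV hcδ hδ (two_le_rank₂ N e hn) (transpose_map_conj_JV F E c N JV hV hJV)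
          (det_JV_ne_zero F E N JV hVd hJV)).toMulEquiv.toMonoidHom) :=
  Representation.Equiv.mk
    ((Submodule.quotEquivOfEq _ _ (TwistedCoinv.augmentation_eq_ker
        (localLemD1DataAtV₂ F E c N e JV hcδ hδ hd hV hVd hJV a 𝓢 hn μ hμn hμc hμF χ v).omega
        (LemD1OfPlace.standingData E v c N JV hcδ hδ (two_le_rank₂ N e hn) (transpose_map_conj_JV F E c N JV hV hJV)
          (det_JV_ne_zero F E N JV hVd hJV)).scalar
        (localLemD1DataAtV₂ F E c N e JV hcδ hδ hd hV hVd hJV a 𝓢 hn μ hμn hμc hμF χ v).chi)).trans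
      ((LemD1OfPlace.coinvEquiv E v c N JV hcδ hδ (two_le_rank₂ N e hn) (transpose_map_conj_JV F E c N JV hV hJV)
          (det_JV_ne_zero F E N JV hVd hJV) (JW F E a)
          (show Representation ℂ (UnitaryGroup.localPi E c N JV v) (SchwartzBruhat (Fin n → v.adicCompletion F)) from
            (𝓢.omegaLoc v).comp (UnitaryGroup.localLineInl E c N e JV (JW F E a) v))
          (μ v) (hμn v) (hμc v) (hμF v) (localCharOfCenter F E c (JW F E a) (JW_apply_ne_zero F E a) χ.1 v)
          (norm_localCharOfCenter F E c (JW F E a) (JW_apply_ne_zero F E a)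
            (norm_chi_eq_one F E c (Algebra.IsQuadraticExtension.finrank_eq_two F E)
              (UnitaryGroup.algEquiv_ne_one_of_apply_eq_neg F E c hcδ hδ) χ) v)
          (continuous_coe_localCharOfCenter F E c (JW F E a) (JW_apply_ne_zero F E a) χ.2.1 v) (JW_apply_ne_zero F E a)).trans
        ((Submodule.quotEquivOfEq _ _ (TwistedCoinv.ker_comp_of_surjective
            (show Representation ℂ (UnitaryGroup.localPi E c 1 (JW F E a) v) (SchwartzBruhat (Fin n → v.adicCompletion F)) from
              ((show Representation ℂ (UnitaryGroup.localPi E c N JV v) _ from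
                (𝓢.omegaLoc v).comp (UnitaryGroup.localLineInl E c N e JV (JW F E a) v)).comp
                (localCenter E c N JV (JW F E a) (JW_apply_ne_zero F E a) v)))
            (localCharOfCenter F E c (JW F E a) (JW_apply_ne_zero F E a) χ.1 v)
            (LemD1OfPlace.theta E v c N JV hcδ hδ (two_le_rank₂ N e hn) (transpose_map_conj_JV F E c N JV hV hJV)
              (det_JV_ne_zero F E N JV hVd hJV) (JW F E a))
            (LemD1OfPlace.theta_surjective E v c N JV hcδ hδ (two_le_rank₂ N e hn) (transpose_map_conj_JV F E c N JV hV hJV)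
              (det_JV_ne_zero F E N JV hVd hJV) (JW F E a) (JW_apply_ne_zero F E a)))).trans
          (Submodule.quotEquivOfEq _ _ (ker_comp_localLineInl_eq F E c N e JV hcδ hδ hd hV hJV a 𝓢 χ v)))))
    (fun _ => LinearMap.ext fun x => Submodule.Quotient.induction_on _ x fun _ => rfl)

end LocalData

section Indexed

/-- **The INDEXED FAMILY of [Liu2021, App. D §D.1]'s data at `v` for a collection `i ↦ (a_i, χ_i, 𝓢_i, μ_{i,•})` of GLOBAL data over one hermitian
space `J_V`, every rank `n ≥ 2`** — the rank-`≥ 2` sibling of ★ `localIndexedFamilyAtV` (`LemD1IndexedFamily`, ★ `LemD1AsPrintedIndexed.lean`),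
SAME BODY: one standing data `U(J_V)(F_v)`; member `i` = Step 2 `μ_{i,v}` (`LemD1OfPlace.muOf`), Step 1 `(a_i·δ) ⊗ 1`, Step 3 `χ_{i,v} ∘ θ`,
⟨CARRIER⟩ `(𝓢_i).omegaLoc v ∘ (k ↦ k ⊗ 1) ∘ uEquiv` = the Weil representation of the θ-package `𝓢_i` at `v` restricted to `U(J_V)(F_v)` —
whose `χ_{i,v}`-quotient is the θ-package LOCAL FACTOR `Θ_v(i)` (`quotEquivLocalType₂`).  `single i` IS `localLemD1DataAtV₂ … (a_i) (𝓢_i) … v`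
(`rfl`); at `3 ≤ n` the family IS the ★ one (`localIndexedFamilyAtV₂_eq`, `rfl`).  The consumer's [Lem. D.1 (4)] AS PRINTED cite at `v` is
`LemD1_4AsPrintedI (localIndexedFamilyAtV₂ … v)` — Liu's (4) read on the triples `(μ_{i,v}, ε_{i,v}, χ_{i,v})`, `i ∈ ι`; intended index
currency for the P5 residual R2″: `i ↦ (θ_i ∈ {λ, λᶜχ̌}, a_i ∈ {a, a′}, χ)`, ONE splitting family `𝓢_i` per member, no det-twist.
[cite: Liu2021, App. D §D.1 Steps 1∕2∕3 (l. 5213–5224) and Lemma D.1 (4) (l. 5235)] -/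
def localIndexedFamilyAtV₂ (hV : TV.IsSymm) (hVd : IsUnit TV.det)
    (hJV : JV = TV.map (algebraMap F E))
    (hn : 2 ≤ n) {ι : Type} (aOf : ι → Fˣ) (χOf : ι → Chi F E c)
    (𝓢Of : ∀ i, LocalSplitting.FinLocalSplittings F E c n hcδ hδ hd (gram F e TV (TW F (aOf i))) (isSymm_gram F e hV (isSymm_TW F (aOf i)))
      (reindex_kronecker_eq_gram_map F E e hJV (JW_eq F E (aOf i))))
    (μOf : ι → ∀ v : HeightOneSpectrum (𝓞 F), (LocalRing E v)ˣ →* ℂˣ) (hμn : ∀ i v x, ‖((μOf i v x : ℂˣ) : ℂ)‖ = 1)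
    (hμc : ∀ i v, Continuous fun x => ((μOf i v x : ℂˣ) : ℂ))
    (hμF : ∀ (i : ι) (v : HeightOneSpectrum (𝓞 F)) (t : (v.adicCompletion F)ˣ),
      μOf i v (Units.map (algebraMap (v.adicCompletion F) (LocalRing E v)).toMonoidHom t) = 1 ↔
        ∃ x : (LocalRing E v)ˣ, (x : LocalRing E v) * conjLocal E c v x = algebraMap (v.adicCompletion F) (LocalRing E v) t)
    (v : HeightOneSpectrum (𝓞 F)) : LemD1IndexedFamily (v.adicCompletion F) (LocalRing E v) N ι where
  isNonarchimedeanLocalField := inferInstance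
  isModuleTopology := LemD1OfPlace.isModuleTopology_localRing E v
  S := LemD1OfPlace.standingData E v c N JV hcδ hδ (two_le_rank₂ N e hn) (transpose_map_conj_JV F E c N JV hV hJV)
    (det_JV_ne_zero F E N JV hVd hJV)
  mu i := LemD1OfPlace.muOf E v c N JV hcδ hδ (two_le_rank₂ N e hn) (transpose_map_conj_JV F E c N JV hV hJV)
    (det_JV_ne_zero F E N JV hVd hJV) (μOf i v) (hμn i v) (hμc i v) (hμF i v)
  eps i := ⟨epsLine E hδ (aOf i) v, epsLine_mem_skew E c N JV hcδ hδ (two_le_rank₂ N e hn) (transpose_map_conj_JV F E c N JV hV hJV)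
    (det_JV_ne_zero F E N JV hVd hJV) (aOf i) v⟩
  chi i := LemD1OfPlace.chiOf E v c N JV hcδ hδ (two_le_rank₂ N e hn) (transpose_map_conj_JV F E c N JV hV hJV)
    (det_JV_ne_zero F E N JV hVd hJV) (JW F E (aOf i)) (localCharOfCenter F E c (JW F E (aOf i)) (JW_apply_ne_zero F E (aOf i)) (χOf i).1 v)
    (norm_localCharOfCenter F E c (JW F E (aOf i)) (JW_apply_ne_zero F E (aOf i))
      (norm_chi_eq_one F E c (Algebra.IsQuadraticExtension.finrank_eq_two F E)
        (UnitaryGroup.algEquiv_ne_one_of_apply_eq_neg F E c hcδ hδ) (χOf i)) v)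
    (continuous_coe_localCharOfCenter F E c (JW F E (aOf i)) (JW_apply_ne_zero F E (aOf i)) (χOf i).2.1 v)
  V _ := SchwartzBruhat (Fin n → v.adicCompletion F)
  omega i := (show Representation ℂ (UnitaryGroup.localPi E c N JV v) (SchwartzBruhat (Fin n → v.adicCompletion F)) from
      ((𝓢Of i).omegaLoc v).comp (UnitaryGroup.localLineInl E c N e JV (JW F E (aOf i)) v)).comp
    (LemD1OfPlace.uEquiv E v c N JV hcδ hδ (two_le_rank₂ N e hn) (transpose_map_conj_JV F E c N JV hV hJV)
      (det_JV_ne_zero F E N JV hVd hJV)).toMulEquiv.toMonoidHom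

/-- **IDENTITY OF RECORDS**: member `i` of the rank-`≥ 2` indexed family IS the datum `localLemD1DataAtV₂` of the global data `i` (`rfl`).
[cite: Liu2021, App. D §D.1 Steps 1∕2∕3 (l. 5213–5224)] -/
theorem single_localIndexedFamilyAtV₂ (hV : TV.IsSymm) (hVd : IsUnit TV.det)
    (hJV : JV = TV.map (algebraMap F E))
    (hn : 2 ≤ n) {ι : Type} (aOf : ι → Fˣ) (χOf : ι → Chi F E c)
    (𝓢Of : ∀ i, LocalSplitting.FinLocalSplittings F E c n hcδ hδ hd (gram F e TV (TW F (aOf i))) (isSymm_gram F e hV (isSymm_TW F (aOf i)))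
      (reindex_kronecker_eq_gram_map F E e hJV (JW_eq F E (aOf i))))
    (μOf : ι → ∀ v : HeightOneSpectrum (𝓞 F), (LocalRing E v)ˣ →* ℂˣ) (hμn : ∀ i v x, ‖((μOf i v x : ℂˣ) : ℂ)‖ = 1)
    (hμc : ∀ i v, Continuous fun x => ((μOf i v x : ℂˣ) : ℂ))
    (hμF : ∀ (i : ι) (v : HeightOneSpectrum (𝓞 F)) (t : (v.adicCompletion F)ˣ),
      μOf i v (Units.map (algebraMap (v.adicCompletion F) (LocalRing E v)).toMonoidHom t) = 1 ↔
        ∃ x : (LocalRing E v)ˣ, (x : LocalRing E v) * conjLocal E c v x = algebraMap (v.adicCompletion F) (LocalRing E v) t)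
    (v : HeightOneSpectrum (𝓞 F)) (i : ι) :
    (localIndexedFamilyAtV₂ F E c N e JV hcδ hδ hd hV hVd hJV hn aOf χOf 𝓢Of μOf hμn hμc hμF v).single i =
      localLemD1DataAtV₂ F E c N e JV hcδ hδ hd hV hVd hJV (aOf i) (𝓢Of i) hn (μOf i) (hμn i) (hμc i) (hμF i) (χOf i) v := rfl

/-- **IDENTITY OF RECORDS across ranks**: at `3 ≤ n` the rank-`≥ 2` indexed family IS the ★ rank-`≥ 3` one `localIndexedFamilyAtV` (`rfl`), so
[Lem. D.1 (1) ∧ (3)] AS PRINTED read on the ★ family and [Lem. D.1 (4)] AS PRINTED read on this one speak about the SAME data.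
[cite: Liu2021, App. D §D.1 Steps 1∕2∕3 (l. 5213–5224)] -/
theorem localIndexedFamilyAtV₂_eq (hV : TV.IsSymm) (hVd : IsUnit TV.det)
    (hJV : JV = TV.map (algebraMap F E))
    (hn : 3 ≤ n) {ι : Type} (aOf : ι → Fˣ) (χOf : ι → Chi F E c)
    (𝓢Of : ∀ i, LocalSplitting.FinLocalSplittings F E c n hcδ hδ hd (gram F e TV (TW F (aOf i))) (isSymm_gram F e hV (isSymm_TW F (aOf i)))
      (reindex_kronecker_eq_gram_map F E e hJV (JW_eq F E (aOf i))))
    (μOf : ι → ∀ v : HeightOneSpectrum (𝓞 F), (LocalRing E v)ˣ →* ℂˣ) (hμn : ∀ i v x, ‖((μOf i v x : ℂˣ) : ℂ)‖ = 1)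
    (hμc : ∀ i v, Continuous fun x => ((μOf i v x : ℂˣ) : ℂ))
    (hμF : ∀ (i : ι) (v : HeightOneSpectrum (𝓞 F)) (t : (v.adicCompletion F)ˣ),
      μOf i v (Units.map (algebraMap (v.adicCompletion F) (LocalRing E v)).toMonoidHom t) = 1 ↔
        ∃ x : (LocalRing E v)ˣ, (x : LocalRing E v) * conjLocal E c v x = algebraMap (v.adicCompletion F) (LocalRing E v) t)
    (v : HeightOneSpectrum (𝓞 F)) :
    localIndexedFamilyAtV₂ F E c N e JV hcδ hδ hd hV hVd hJV (le_trans (by norm_num) hn) aOf χOf 𝓢Of μOf hμn hμc hμF v =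
      localIndexedFamilyAtV F E c N e JV hcδ hδ hd hV hVd hJV hn aOf χOf 𝓢Of μOf hμn hμc hμF v := rfl

end Indexed

/-! ## §5 The read-backs: «isomorphic» ∕ «nonzero» of the family's `quot` ARE those of the θ-package local factors `Θ_v`; item (4) on `Θ_v` -/

section Generic

variable {k : Type*} [Field k] {G₁ G₂ V₁ V₂ W₁ W₂ : Type*} [Group G₁] [Group G₂]
  [AddCommGroup V₁] [Module ℂ V₁] [AddCommGroup V₂] [Module ℂ V₂] [AddCommGroup W₁] [Module ℂ W₁] [AddCommGroup W₂] [Module ℂ W₂]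

/-- **«isomorphic» transports along equivalences onto pulled-back representations** (bookkeeping): if `ρ₁ ≃ σ₁ ∘ φ` and `ρ₂ ≃ σ₂ ∘ φ`
equivariantly with `φ : G₁ ≃* G₂`, then `ρ₁ ≅ ρ₂` iff `σ₁ ≅ σ₂` (READING L7, ★ `AreIsomorphicRep`).
[cite: Liu2021, App. D Lemma D.1 (2)–(4) (l. 5231–5235)] -/
theorem areIsomorphicRep_iff_of_equiv_comp {ρ₁ : Representation ℂ G₁ V₁} {ρ₂ : Representation ℂ G₁ V₂}
    {σ₁ : Representation ℂ G₂ W₁} {σ₂ : Representation ℂ G₂ W₂} (φ : G₁ ≃* G₂)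
    (E₁ : ρ₁.Equiv (show Representation ℂ G₁ W₁ from σ₁.comp φ.toMonoidHom))
    (E₂ : ρ₂.Equiv (show Representation ℂ G₁ W₂ from σ₂.comp φ.toMonoidHom)) :
    AreIsomorphicRep ρ₁ ρ₂ ↔ AreIsomorphicRep σ₁ σ₂ := by
  have h₁ : ∀ (g : G₁) (x : V₁), E₁.toLinearEquiv (ρ₁ g x) = σ₁ (φ g) (E₁.toLinearEquiv x) := fun g x => by
    rw [Representation.Equiv.toLinearEquiv_apply, Representation.Equiv.toLinearEquiv_apply]
    exact E₁.toIntertwiningMap.isIntertwining _ _ g x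
  have h₂ : ∀ (g : G₁) (x : V₂), E₂.toLinearEquiv (ρ₂ g x) = σ₂ (φ g) (E₂.toLinearEquiv x) := fun g x => by
    rw [Representation.Equiv.toLinearEquiv_apply, Representation.Equiv.toLinearEquiv_apply]
    exact E₂.toIntertwiningMap.isIntertwining _ _ g x
  constructor
  · rintro ⟨f, hf⟩
    refine ⟨E₁.toLinearEquiv.symm.trans (f.trans E₂.toLinearEquiv), fun g w => ?_⟩
    -- move `w` back to `V₁` along `E₁`, act there, and push forward along `f`, `E₂`
    obtain ⟨g₁, rfl⟩ := φ.surjective g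
    obtain ⟨x, rfl⟩ := E₁.toLinearEquiv.surjective w
    simp only [LinearEquiv.trans_apply]
    rw [← h₁ g₁ x, LinearEquiv.symm_apply_apply, LinearEquiv.symm_apply_apply, hf g₁ x, h₂ g₁ (f x)]
  · rintro ⟨f, hf⟩
    refine ⟨E₁.toLinearEquiv.trans (f.trans E₂.toLinearEquiv.symm), fun g x => ?_⟩
    simp only [LinearEquiv.trans_apply]
    rw [h₁ g x, hf (φ g) (E₁.toLinearEquiv x)]
    apply E₂.toLinearEquiv.injective
    rw [LinearEquiv.apply_symm_apply, h₂ g, LinearEquiv.apply_symm_apply]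

end Generic

section ReadBack

/-- **(r1, «isomorphic»)** For members `i, j` of the rank-`≥ 2` θ-package family at `v`: the as-printed «`ω(μ_{j,v}, ε_{j,v}, χ_{j,v})` is isomorphic
to `ω(μ_{i,v}, ε_{i,v}, χ_{i,v})`» (`AreIsomorphicRep` of the family's `quot`, representations of `U(V)(F_v) = S.U`) holds IFF the θ-package LOCAL
FACTORS `Θ_v(j) ≅ Θ_v(i)` as representations of `U(J_V)(F_v)` (`Θ_v(i) = TwistedCoinv.rep (χ_{i,v}) ((𝓢_i).omegaLoc v) _ ∘ (k ↦ k ⊗ 1)`), through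
`quotEquivLocalType₂` and the isomorphism `uEquiv : S.U ≃* U(J_V)(F_v)`. [cite: Liu2021, App. D Lemma D.1 (4) (l. 5235) and §D.1 Step 3 (l. 5221)] -/
theorem areIsomorphicRep_localType₂_iff_quot (hV : TV.IsSymm) (hVd : IsUnit TV.det)
    (hJV : JV = TV.map (algebraMap F E))
    (hn : 2 ≤ n) {ι : Type} (aOf : ι → Fˣ) (χOf : ι → Chi F E c)
    (𝓢Of : ∀ i, LocalSplitting.FinLocalSplittings F E c n hcδ hδ hd (gram F e TV (TW F (aOf i))) (isSymm_gram F e hV (isSymm_TW F (aOf i)))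
      (reindex_kronecker_eq_gram_map F E e hJV (JW_eq F E (aOf i))))
    (μOf : ι → ∀ v : HeightOneSpectrum (𝓞 F), (LocalRing E v)ˣ →* ℂˣ) (hμn : ∀ i v x, ‖((μOf i v x : ℂˣ) : ℂ)‖ = 1)
    (hμc : ∀ i v, Continuous fun x => ((μOf i v x : ℂˣ) : ℂ))
    (hμF : ∀ (i : ι) (v : HeightOneSpectrum (𝓞 F)) (t : (v.adicCompletion F)ˣ),
      μOf i v (Units.map (algebraMap (v.adicCompletion F) (LocalRing E v)).toMonoidHom t) = 1 ↔
        ∃ x : (LocalRing E v)ˣ, (x : LocalRing E v) * conjLocal E c v x = algebraMap (v.adicCompletion F) (LocalRing E v) t)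
    (v : HeightOneSpectrum (𝓞 F)) (i j : ι) :
    AreIsomorphicRep ((localIndexedFamilyAtV₂ F E c N e JV hcδ hδ hd hV hVd hJV hn aOf χOf 𝓢Of μOf hμn hμc hμF v).quot j)
        ((localIndexedFamilyAtV₂ F E c N e JV hcδ hδ hd hV hVd hJV hn aOf χOf 𝓢Of μOf hμn hμc hμF v).quot i) ↔
      AreIsomorphicRep
        (show Representation ℂ (UnitaryGroup.localPi E c N JV v) _ from
          (TwistedCoinv.rep (localCharOfCenter F E c (JW F E (aOf j)) (JW_apply_ne_zero F E (aOf j)) (χOf j).1 v) ((𝓢Of j).omegaLoc v)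
            (commute_omegaLoc_localCenter F E c N e JV (JW F E (aOf j)) hcδ hδ hd hV (isSymm_TW F (aOf j)) hJV (JW_eq F E (aOf j))
              (JW_apply_ne_zero F E (aOf j)) (𝓢Of j) v)).comp (UnitaryGroup.localLineInl E c N e JV (JW F E (aOf j)) v))
        (show Representation ℂ (UnitaryGroup.localPi E c N JV v) _ from
          (TwistedCoinv.rep (localCharOfCenter F E c (JW F E (aOf i)) (JW_apply_ne_zero F E (aOf i)) (χOf i).1 v) ((𝓢Of i).omegaLoc v)
            (commute_omegaLoc_localCenter F E c N e JV (JW F E (aOf i)) hcδ hδ hd hV (isSymm_TW F (aOf i)) hJV (JW_eq F E (aOf i))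
              (JW_apply_ne_zero F E (aOf i)) (𝓢Of i) v)).comp (UnitaryGroup.localLineInl E c N e JV (JW F E (aOf i)) v)) :=
  areIsomorphicRep_iff_of_equiv_comp
    (LemD1OfPlace.uEquiv E v c N JV hcδ hδ (two_le_rank₂ N e hn) (transpose_map_conj_JV F E c N JV hV hJV)
      (det_JV_ne_zero F E N JV hVd hJV)).toMulEquiv
    (quotEquivLocalType₂ F E c N e JV hcδ hδ hd hV hVd hJV (aOf j) (𝓢Of j) hn (μOf j) (hμn j) (hμc j) (hμF j) (χOf j) v)
    (quotEquivLocalType₂ F E c N e JV hcδ hδ hd hV hVd hJV (aOf i) (𝓢Of i) hn (μOf i) (hμn i) (hμc i) (hμF i) (χOf i) v)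

/-- **(r1, «nonzero»)** For a member `i` of the rank-`≥ 2` θ-package family at `v`: the as-printed «`ω(μ_{i,v}, ε_{i,v}, χ_{i,v})` is nonzero»
(the family's quotient space `Non-trivial`, READING L5) holds IFF the space `Coinv((𝓢_i).omegaLoc v ∘ (z·1_n), χ_{i,v})` of the θ-package local
factor `Θ_v(i)` is non-trivial (the carrier of `quotEquivLocalType₂`). [cite: Liu2021, App. D Lemma D.1 (4) (l. 5235) and §D.1 Step 3 (l. 5221)] -/
theorem nontrivial_localType₂_iff_quot (hV : TV.IsSymm) (hVd : IsUnit TV.det)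
    (hJV : JV = TV.map (algebraMap F E))
    (hn : 2 ≤ n) {ι : Type} (aOf : ι → Fˣ) (χOf : ι → Chi F E c)
    (𝓢Of : ∀ i, LocalSplitting.FinLocalSplittings F E c n hcδ hδ hd (gram F e TV (TW F (aOf i))) (isSymm_gram F e hV (isSymm_TW F (aOf i)))
      (reindex_kronecker_eq_gram_map F E e hJV (JW_eq F E (aOf i))))
    (μOf : ι → ∀ v : HeightOneSpectrum (𝓞 F), (LocalRing E v)ˣ →* ℂˣ) (hμn : ∀ i v x, ‖((μOf i v x : ℂˣ) : ℂ)‖ = 1)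
    (hμc : ∀ i v, Continuous fun x => ((μOf i v x : ℂˣ) : ℂ))
    (hμF : ∀ (i : ι) (v : HeightOneSpectrum (𝓞 F)) (t : (v.adicCompletion F)ˣ),
      μOf i v (Units.map (algebraMap (v.adicCompletion F) (LocalRing E v)).toMonoidHom t) = 1 ↔
        ∃ x : (LocalRing E v)ˣ, (x : LocalRing E v) * conjLocal E c v x = algebraMap (v.adicCompletion F) (LocalRing E v) t)
    (v : HeightOneSpectrum (𝓞 F)) (i : ι) :
    Nontrivial ((localIndexedFamilyAtV₂ F E c N e JV hcδ hδ hd hV hVd hJV hn aOf χOf 𝓢Of μOf hμn hμc hμF v).V i ⧸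
        augmentation ((localIndexedFamilyAtV₂ F E c N e JV hcδ hδ hd hV hVd hJV hn aOf χOf 𝓢Of μOf hμn hμc hμF v).omega i)
          (localIndexedFamilyAtV₂ F E c N e JV hcδ hδ hd hV hVd hJV hn aOf χOf 𝓢Of μOf hμn hμc hμF v).S.scalar
          ((localIndexedFamilyAtV₂ F E c N e JV hcδ hδ hd hV hVd hJV hn aOf χOf 𝓢Of μOf hμn hμc hμF v).chi i).1) ↔
      Nontrivial (TwistedCoinv.Coinv
        (show Representation ℂ (UnitaryGroup.localPi E c 1 (JW F E (aOf i)) v) (SchwartzBruhat (Fin n → v.adicCompletion F)) from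
          ((𝓢Of i).omegaLoc v).comp (localCenter E c n (Matrix.reindex e e (JV ⊗ₖ JW F E (aOf i))) (JW F E (aOf i)) (JW_apply_ne_zero F E (aOf i)) v))
        (localCharOfCenter F E c (JW F E (aOf i)) (JW_apply_ne_zero F E (aOf i)) (χOf i).1 v)) :=
  (quotEquivLocalType₂ F E c N e JV hcδ hδ hd hV hVd hJV (aOf i) (𝓢Of i) hn (μOf i) (hμn i) (hμc i) (hμF i) (χOf i) v).toLinearEquiv.toEquiv.nontrivial_congr

/-- **(r1) [Liu2021, Lem. D.1 (4)] AS PRINTED, read on the θ-package family at `v`, SAYS — in the local-factor tokens the P5 residual R2″ uses:**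
for `N = 2` and members `i, j` with `Θ_v(i) ≠ 0`: «`Θ_v(j) ≅ Θ_v(i)` (as representations of `U(J_V)(F_v)`) IFF EITHER `μ_{j,v} = μ_{i,v}` ∧ the
Step-1 representatives `(a_i·δ) ⊗ 1 ~ (a_j·δ) ⊗ 1` (same class in `E_v^{−×}/Nm E_v^×`) ∧ `χ_{j,v}∘θ = χ_{i,v}∘θ`, OR `μ_{j,v} = μ_{i,v}^c · χ̌_{i,v}`
(★ `LemD1.muTwist`, LOCAL `χ̌`) ∧ `χ_{j,v}∘θ = χ_{i,v}∘θ` ∧ (`(E_v^N, J_V)` isotropic → same class) ∧ (anisotropic → different class)».  Pure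
unfolding of the cite along `areIsomorphicRep_localType₂_iff_quot` ∕ `nontrivial_localType₂_iff_quot`; nothing of [Liu2021] is asserted (the cite
is the hypothesis `h4`).  The `⊗'`-assembly of the `Θ_v(i)` into the finite-adelic carrier at the line `⟨a_i⟩` is ★
`exists_isRestrictedTensorProductRep_chiSplittingLine_omegaPi_center` ∕ ★ `exists_equiv_rhoVAtLine_chiSplittingLine_omega_center` (cited, not
re-proved). [cite: Liu2021, App. D Lemma D.1 (4) (l. 5235); Def. 4.11 (l. 2092–2096)] -/
theorem lemD1_4_localFactors_of_lemD1_4AsPrintedI₂ (hV : TV.IsSymm) (hVd : IsUnit TV.det)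
    (hJV : JV = TV.map (algebraMap F E))
    (hn : 2 ≤ n) {ι : Type} (aOf : ι → Fˣ) (χOf : ι → Chi F E c)
    (𝓢Of : ∀ i, LocalSplitting.FinLocalSplittings F E c n hcδ hδ hd (gram F e TV (TW F (aOf i))) (isSymm_gram F e hV (isSymm_TW F (aOf i)))
      (reindex_kronecker_eq_gram_map F E e hJV (JW_eq F E (aOf i))))
    (μOf : ι → ∀ v : HeightOneSpectrum (𝓞 F), (LocalRing E v)ˣ →* ℂˣ) (hμn : ∀ i v x, ‖((μOf i v x : ℂˣ) : ℂ)‖ = 1)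
    (hμc : ∀ i v, Continuous fun x => ((μOf i v x : ℂˣ) : ℂ))
    (hμF : ∀ (i : ι) (v : HeightOneSpectrum (𝓞 F)) (t : (v.adicCompletion F)ˣ),
      μOf i v (Units.map (algebraMap (v.adicCompletion F) (LocalRing E v)).toMonoidHom t) = 1 ↔
        ∃ x : (LocalRing E v)ˣ, (x : LocalRing E v) * conjLocal E c v x = algebraMap (v.adicCompletion F) (LocalRing E v) t)
    (v : HeightOneSpectrum (𝓞 F))
    (h4 : LemD1_4AsPrintedI (localIndexedFamilyAtV₂ F E c N e JV hcδ hδ hd hV hVd hJV hn aOf χOf 𝓢Of μOf hμn hμc hμF v))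
    (hN : N = 2) (i j : ι)
    (hi : Nontrivial (TwistedCoinv.Coinv
      (show Representation ℂ (UnitaryGroup.localPi E c 1 (JW F E (aOf i)) v) (SchwartzBruhat (Fin n → v.adicCompletion F)) from
        ((𝓢Of i).omegaLoc v).comp (localCenter E c n (Matrix.reindex e e (JV ⊗ₖ JW F E (aOf i))) (JW F E (aOf i)) (JW_apply_ne_zero F E (aOf i)) v))
      (localCharOfCenter F E c (JW F E (aOf i)) (JW_apply_ne_zero F E (aOf i)) (χOf i).1 v))) :
    letI : IsModuleTopology (v.adicCompletion F) (LocalRing E v) := LemD1OfPlace.isModuleTopology_localRing E v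
    AreIsomorphicRep
        (show Representation ℂ (UnitaryGroup.localPi E c N JV v) _ from
          (TwistedCoinv.rep (localCharOfCenter F E c (JW F E (aOf j)) (JW_apply_ne_zero F E (aOf j)) (χOf j).1 v) ((𝓢Of j).omegaLoc v)
            (commute_omegaLoc_localCenter F E c N e JV (JW F E (aOf j)) hcδ hδ hd hV (isSymm_TW F (aOf j)) hJV (JW_eq F E (aOf j))
              (JW_apply_ne_zero F E (aOf j)) (𝓢Of j) v)).comp (UnitaryGroup.localLineInl E c N e JV (JW F E (aOf j)) v))
        (show Representation ℂ (UnitaryGroup.localPi E c N JV v) _ from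
          (TwistedCoinv.rep (localCharOfCenter F E c (JW F E (aOf i)) (JW_apply_ne_zero F E (aOf i)) (χOf i).1 v) ((𝓢Of i).omegaLoc v)
            (commute_omegaLoc_localCenter F E c N e JV (JW F E (aOf i)) hcδ hδ hd hV (isSymm_TW F (aOf i)) hJV (JW_eq F E (aOf i))
              (JW_apply_ne_zero F E (aOf i)) (𝓢Of i) v)).comp (UnitaryGroup.localLineInl E c N e JV (JW F E (aOf i)) v)) ↔
      (((localIndexedFamilyAtV₂ F E c N e JV hcδ hδ hd hV hVd hJV hn aOf χOf 𝓢Of μOf hμn hμc hμF v).mu j =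
            (localIndexedFamilyAtV₂ F E c N e JV hcδ hδ hd hV hVd hJV hn aOf χOf 𝓢Of μOf hμn hμc hμF v).mu i ∧
          LemD1.SameClass ((localIndexedFamilyAtV₂ F E c N e JV hcδ hδ hd hV hVd hJV hn aOf χOf 𝓢Of μOf hμn hμc hμF v).eps i)
            ((localIndexedFamilyAtV₂ F E c N e JV hcδ hδ hd hV hVd hJV hn aOf χOf 𝓢Of μOf hμn hμc hμF v).eps j) ∧
          (localIndexedFamilyAtV₂ F E c N e JV hcδ hδ hd hV hVd hJV hn aOf χOf 𝓢Of μOf hμn hμc hμF v).chi j =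
            (localIndexedFamilyAtV₂ F E c N e JV hcδ hδ hd hV hVd hJV hn aOf χOf 𝓢Of μOf hμn hμc hμF v).chi i) ∨
        ((localIndexedFamilyAtV₂ F E c N e JV hcδ hδ hd hV hVd hJV hn aOf χOf 𝓢Of μOf hμn hμc hμF v).mu j =
            LemD1.muTwist ((localIndexedFamilyAtV₂ F E c N e JV hcδ hδ hd hV hVd hJV hn aOf χOf 𝓢Of μOf hμn hμc hμF v).mu i)
              ((localIndexedFamilyAtV₂ F E c N e JV hcδ hδ hd hV hVd hJV hn aOf χOf 𝓢Of μOf hμn hμc hμF v).chi i) ∧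
          (localIndexedFamilyAtV₂ F E c N e JV hcδ hδ hd hV hVd hJV hn aOf χOf 𝓢Of μOf hμn hμc hμF v).chi j =
            (localIndexedFamilyAtV₂ F E c N e JV hcδ hδ hd hV hVd hJV hn aOf χOf 𝓢Of μOf hμn hμc hμF v).chi i ∧
          (LemD1.IsIsotropic (LemD1OfPlace.standingData E v c N JV hcδ hδ (two_le_rank₂ N e hn) (transpose_map_conj_JV F E c N JV hV hJV)
              (det_JV_ne_zero F E N JV hVd hJV)) →
            LemD1.SameClass ((localIndexedFamilyAtV₂ F E c N e JV hcδ hδ hd hV hVd hJV hn aOf χOf 𝓢Of μOf hμn hμc hμF v).eps i)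
              ((localIndexedFamilyAtV₂ F E c N e JV hcδ hδ hd hV hVd hJV hn aOf χOf 𝓢Of μOf hμn hμc hμF v).eps j)) ∧
          (¬ LemD1.IsIsotropic (LemD1OfPlace.standingData E v c N JV hcδ hδ (two_le_rank₂ N e hn) (transpose_map_conj_JV F E c N JV hV hJV)
              (det_JV_ne_zero F E N JV hVd hJV)) →
            ¬ LemD1.SameClass ((localIndexedFamilyAtV₂ F E c N e JV hcδ hδ hd hV hVd hJV hn aOf χOf 𝓢Of μOf hμn hμc hμF v).eps i)
              ((localIndexedFamilyAtV₂ F E c N e JV hcδ hδ hd hV hVd hJV hn aOf χOf 𝓢Of μOf hμn hμc hμF v).eps j)))) := by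
  rw [← areIsomorphicRep_localType₂_iff_quot F E c N e JV hcδ hδ hd hV hVd hJV hn aOf χOf 𝓢Of μOf hμn hμc hμF v i j]
  exact h4 hN i ((nontrivial_localType₂_iff_quot F E c N e JV hcδ hδ hd hV hVd hJV hn aOf χOf 𝓢Of μOf hμn hμc hμF v i).2 hi) j

end ReadBack

end Literature.NumberTheory.Automorphic.Liu2021.Def411WeilCarriers

end
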